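import Summits.QuantumFields.QCD.Theorems.HeatSlicedQuarksQuarkLoopCoefficientSecondOrderExpansionAuxK
import Summits.QuantumFields.QCD.Theorems.HeatSlicedQuarksQuarkLoopCoefficientSecondOrderCoefficientAuxB
import Summits.QuantumFields.QCD.Theorems.HeatSlicedQuarksQuarkLoopCoefficientTwistedDuhamel

/-!
# The `t⁻²`-Gaussian majorant of the symmetric-gauge heat symbol — part A: the zeroth-order remainder
(line `Sketch` of crux stmt-QuantumFields-16786, stub `stub_gaussianMajorant`, helper file; lead prover)

The zeroth-order remainder `R₀ = E_θ − E₀` (`E_θ = symHeat θ`, `E₀(s) = k_s•1 = pert0 s`) and its forcing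
`q₀ = V_θ E₀ − vtx0 E₀`:

* the SHARP bound of the first-order vertex on the free kernel, `‖vtx 1 (k_s•1)‖ ≤ A Γ` (first Moyal cancellation:
  the `v∧w` part of the vertex phase drops out on the scalar free symbol — no `√(1+s)` growth), hence
  `‖q₀(θ,s,w)‖ ≤ K (θ²(1+s) + |θ|) Γ_{c_k/4}(s,w)` (cocycle Taylor remainder at order two + `θ ×` Moyal-cancelled vertex);
* the ODE `∂_s R₀ = −V_θ R₀ − q₀`, `R₀(0) = 0`, continuity and uniform bounds of the entries;
* the twisted Duhamel representation `R₀(t) = −∫₀ᵗ E_θ(t−s) ⋆_θ q₀(s) ds` (registered aux stub `stub_twistedDuhamel`).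

Part B (`…GaussianMajorant.lean`) runs the smallness bootstrap on top of this.
-/

noncomputable section

namespace Summit.QuantumFields.QCD.Cruxes.QuarkLoopCoefficient.Sketch

open Literature.MathematicalPhysics.QuantumLattice Literature.MathematicalPhysics.QuantumFieldTheory
open Literature.Probability.LatticeModels (Site)
open Summit.QuantumFields.QCD.Theorems.QuarkLoopCoefficient
open Summit.QuantumFields.QCD.Cruxes.QuarkLoopCoefficient.Sketch.HeatSeries
open Summit.QuantumFields.QCD.Cruxes.QuarkLoopCoefficient.Sketch.FreeMajorantToolkit
open Summit.QuantumFields.QCD.Cruxes.QuarkLoopCoefficient.Sketch.SymmetricGauge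
open Summit.QuantumFields.QCD.Cruxes.QuarkLoopCoefficient.Sketch.SecondOrderExpansion
open scoped Matrix ComplexConjugate

attribute [local irreducible] nbr nbr2

namespace GaussianMajorant

/-- The twisted generator `(V_θ f)(w) = Σ_{v ∈ nbr2 0} Ω_θ(v, w) • (ȟ_θ(v) f(w − v))` (local notation). -/
local notation "V[" θ "]" => (fun (f : Site 4 → Spin) (w : Site 4) =>
  ∑ v ∈ nbr2 0, Complex.exp (((θ / 2 * (wedge v w : ℤ) : ℝ) : ℂ) * Complex.I) • (sqKer (symLink θ) 0 v * f (w - v)))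

/-- The zeroth-order forcing `q₀(θ, s, w) = (V_θ E₀(s))(w) − (vtx0 E₀(s))(w)` (local notation). -/
local notation "Q₀[" θ "," s "," w "]" => (V[θ] (pert0 s) w - vtx 0 (pert0 s) w)

/-! ## §1 The zeroth-order forcing -/

/-- A nonnegative free-kernel constant: `0 ≤ C_k` (indeed `1 ≤ C_k`, from `k_0(0) = 1`). -/
theorem one_le_Ck {Ck ck : ℝ}
    (hk : ∀ t : ℝ, 0 ≤ t → ∀ w : Site 4, |freeKer t w| ≤ Ck * gaussProfile ck t w)
    (h3 : ∀ w : Site 4, freeKer 0 w = if w = 0 then 1 else 0) : 1 ≤ Ck := by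
  have := hk 0 le_rfl 0
  rw [h3, gaussProfile_zero_right] at this
  simpa using this

/-- **Sharp bound of the first-order vertex on the free kernel** (first Moyal cancellation):
`‖(vtx 1 (k_s•1))(w)_{γδ}‖ ≤ A Γ_{c_k/2}(s,w)` — no `√(1+s)` growth. -/
theorem exists_norm_vtx_one_pert0_apply_le {Ck ck : ℝ} (hck : 0 < ck)
    (hk : ∀ t : ℝ, 0 ≤ t → ∀ w : Site 4, |freeKer t w| ≤ Ck * gaussProfile ck t w)
    (hT4 : ∀ c ε : ℝ, 0 < c → 0 < ε → ε < 1 → ∃ A : ℝ, ∀ t : ℝ, 0 ≤ t → ∀ w z : Site 4, elen z ≤ 2 →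
      gaussProfile c t (w + z) ≤ A * gaussProfile ((1 - ε) * c) t w)
    (h1 : ∀ x y : Site 4, sqKer (fun _ => (1 : ℂ)) x y = ((hhat (y - x) : ℝ) : ℂ) • (1 : Spin))
    (h3 : ∀ w : Site 4, freeKer 0 w = if w = 0 then 1 else 0)
    (h6 : ∀ t : ℝ, 0 ≤ t → ∀ (w : Site 4) (ν : Fin 4),
      t * (∑ z ∈ nbr2 0, ((z ν : ℤ) : ℝ) * hhat z * freeKer t (w - z)) + ((w ν : ℤ) : ℝ) * freeKer t w = 0) :
    ∃ A : ℝ, 0 ≤ A ∧ ∀ s : ℝ, 0 ≤ s → ∀ (w : Site 4) (γ δ : Fin 4),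
      ‖vtx 1 (pert0 s) w γ δ‖ ≤ A * gaussProfile (ck / 2) s w := by
  obtain ⟨A, hA0, hA⟩ := exists_sum_nbr2_gaussProfile_le hT4 hck
  have hCk : 0 ≤ Ck := zero_le_one.trans (one_le_Ck hk h3)
  refine ⟨10368 * Ck * A, by positivity, fun s hs w γ δ => ?_⟩
  rw [SecondOrderCoefficient.vtx_one_pert0 h1 h3 h6 hs w, Matrix.sum_apply]
  refine (norm_sum_le _ _).trans ?_
  have hterm : ∀ v ∈ nbr2 0, ‖(((freeKer s (w - v) : ℝ) : ℂ) •
      ∑ z ∈ nbr 0, (Complex.I / 2 * ((wedge z v : ℤ) : ℂ)) • (dsharp z * dsymb (v - z))) γ δ‖ ≤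
      10368 * Ck * gaussProfile ck s (w - v) := by
    intro v hv
    have hη : (∑ z ∈ nbr 0, (Complex.I / 2 * ((wedge z v : ℤ) : ℂ)) • (dsharp z * dsymb (v - z))) =
        (Complex.I / 2) • ∑ z ∈ nbr 0, ((wedge z v : ℤ) : ℂ) • (dsharp z * dsymb (v - z)) := by
      rw [Finset.smul_sum]
      refine Finset.sum_congr rfl fun z _ => ?_
      rw [smul_smul]
    rw [hη, Matrix.smul_apply, smul_eq_mul, norm_mul, Complex.norm_real, Real.norm_eq_abs, Matrix.smul_apply,
      smul_eq_mul, norm_mul]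
    have hI : ‖Complex.I / 2‖ = 1 / 2 := by simp
    rw [hI]
    have h1' := norm_eta_apply_le hv γ δ
    have h2' := hk s hs (w - v)
    have hΓ := gaussProfile_nonneg ck s (w - v)
    calc |freeKer s (w - v)| * (1 / 2 * ‖(∑ z ∈ nbr 0, ((wedge z v : ℤ) : ℂ) • (dsharp z * dsymb (v - z))) γ δ‖)
        ≤ Ck * gaussProfile ck s (w - v) * (1 / 2 * 20736) := by gcongr
      _ = 10368 * Ck * gaussProfile ck s (w - v) := by ring
  refine (Finset.sum_le_sum hterm).trans ?_
  rw [← Finset.mul_sum]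
  calc 10368 * Ck * ∑ v ∈ nbr2 0, gaussProfile ck s (w - v) ≤ 10368 * Ck * (A * gaussProfile (ck / 2) s w) :=
        mul_le_mul_of_nonneg_left (hA s hs w) (by positivity)
    _ = _ := by ring

/-- **Bound of the zeroth-order forcing**: `‖q₀(θ,s,w)_{γδ}‖ ≤ K (θ²(1+s) + |θ|) Γ_{c_k/4}(s,w)` — the cocycle
Taylor remainder at order two plus `θ` times the Moyal-cancelled first-order vertex. -/
theorem exists_forcing₀_bound {Ck ck : ℝ} (hck : 0 < ck)
    (hk : ∀ t : ℝ, 0 ≤ t → ∀ w : Site 4, |freeKer t w| ≤ Ck * gaussProfile ck t w)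
    (hT3 : ∀ c ε : ℝ, 0 < c → 0 < ε → ε < 1 → ∀ j : ℕ, ∃ A : ℝ, ∀ t : ℝ, 0 ≤ t → ∀ w : Site 4,
      elen w ^ j * gaussProfile c t w ≤ A * Real.sqrt (1 + t) ^ j * gaussProfile ((1 - ε) * c) t w)
    (hT4 : ∀ c ε : ℝ, 0 < c → 0 < ε → ε < 1 → ∃ A : ℝ, ∀ t : ℝ, 0 ≤ t → ∀ w z : Site 4, elen z ≤ 2 →
      gaussProfile c t (w + z) ≤ A * gaussProfile ((1 - ε) * c) t w)
    (h1 : ∀ x y : Site 4, sqKer (fun _ => (1 : ℂ)) x y = ((hhat (y - x) : ℝ) : ℂ) • (1 : Spin))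
    (h3 : ∀ w : Site 4, freeKer 0 w = if w = 0 then 1 else 0)
    (h6 : ∀ t : ℝ, 0 ≤ t → ∀ (w : Site 4) (ν : Fin 4),
      t * (∑ z ∈ nbr2 0, ((z ν : ℤ) : ℝ) * hhat z * freeKer t (w - z)) + ((w ν : ℤ) : ℝ) * freeKer t w = 0) :
    ∃ K : ℝ, 0 ≤ K ∧ ∀ θ : ℝ, ∀ s : ℝ, 0 ≤ s → ∀ (w : Site 4) (γ δ : Fin 4),
      ‖(Q₀[θ, s, w]) γ δ‖ ≤ K * (θ ^ 2 * (1 + s) + |θ|) * gaussProfile (ck / 4) s w := by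
  obtain ⟨K₁, hK₁0, hK₁⟩ :=
    exists_norm_twistedRem_apply_le_of_profile hT3 hT4 hck (m := 2) (k := 1) (by norm_num)
  obtain ⟨A, hA0, hA⟩ := exists_norm_vtx_one_pert0_apply_le hck hk hT4 h1 h3 h6
  have hCk : 0 ≤ Ck := zero_le_one.trans (one_le_Ck hk h3)
  refine ⟨K₁ * Ck + A, by positivity, fun θ s hs w γ δ => ?_⟩
  have hsplit : Q₀[θ, s, w] =
      (V[θ] (pert0 s) w - ∑ j ∈ Finset.range 2, (θ : ℂ) ^ j • vtx j (pert0 s) w) + (θ : ℂ) • vtx 1 (pert0 s) w := by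
    simp only [Finset.sum_range_succ, Finset.sum_range_zero, zero_add, pow_zero, one_smul, pow_one]
    abel
  rw [hsplit, Matrix.add_apply, Matrix.smul_apply, smul_eq_mul]
  refine (norm_add_le _ _).trans ?_
  have hrem := hK₁ θ s hs Ck hCk (pert0 s) (fun y γ' δ' => norm_pert0_apply_le hk hs y γ' δ') w γ δ
  have hv1 := hA s hs w γ δ
  rw [norm_mul, Complex.norm_real, Real.norm_eq_abs]
  have hΓ24 : gaussProfile (ck / 2) s w ≤ gaussProfile (ck / 4) s w := gaussProfile_anti (by linarith) hs w
  have hΓ := gaussProfile_nonneg (ck / 4) s w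
  have hθ := abs_nonneg θ
  have hv1' : |θ| * ‖vtx 1 (pert0 s) w γ δ‖ ≤ |θ| * (A * gaussProfile (ck / 4) s w) :=
    mul_le_mul_of_nonneg_left (hv1.trans (mul_le_mul_of_nonneg_left hΓ24 hA0)) hθ
  have hrem' : ‖(V[θ] (pert0 s) w - ∑ j ∈ Finset.range 2, (θ : ℂ) ^ j • vtx j (pert0 s) w) γ δ‖ ≤
      K₁ * Ck * (θ ^ 2 * (1 + s)) * gaussProfile (ck / 4) s w := by
    refine hrem.trans (le_of_eq ?_)
    rw [pow_one, ← sq_abs θ]; ring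
  have hextra : 0 ≤ K₁ * Ck * |θ| * gaussProfile (ck / 4) s w + A * (θ ^ 2 * (1 + s)) * gaussProfile (ck / 4) s w := by
    have : 0 ≤ 1 + s := by linarith
    positivity
  calc ‖(V[θ] (pert0 s) w - ∑ j ∈ Finset.range 2, (θ : ℂ) ^ j • vtx j (pert0 s) w) γ δ‖ +
        |θ| * ‖vtx 1 (pert0 s) w γ δ‖
      ≤ K₁ * Ck * (θ ^ 2 * (1 + s)) * gaussProfile (ck / 4) s w + |θ| * (A * gaussProfile (ck / 4) s w) :=
        add_le_add hrem' hv1'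
    _ ≤ _ := by nlinarith [hextra]

/-! ## §2 The zeroth-order remainder `R₀ = E_θ − E₀`: ODE, initial value, continuity, bounds -/

/-- **ODE of `R₀`**: `∂_s (E_θ − E₀)(s)(w)_{αβ} = (−V_θ (E_θ − E₀)(s) (w) − q₀(θ,s,w))_{αβ}`. -/
theorem hasDerivAt_remainder₀_apply
    (h1 : ∀ x y : Site 4, sqKer (fun _ => (1 : ℂ)) x y = ((hhat (y - x) : ℝ) : ℂ) • (1 : Spin))
    (h4 : ∀ (t : ℝ) (w : Site 4),
      HasDerivAt (fun s => freeKer s w) (-(∑ z ∈ nbr2 0, hhat z * freeKer t (w - z))) t)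
    (θ s : ℝ) (w : Site 4) (α β : Fin 4) :
    HasDerivAt (fun r : ℝ => (symHeat θ r w - pert0 r w) α β)
      ((-(∑ v ∈ nbr2 0, Complex.exp (((θ / 2 * (wedge v w : ℤ) : ℝ) : ℂ) * Complex.I) •
          (sqKer (symLink θ) 0 v * (symHeat θ s (w - v) - pert0 s (w - v)))) - Q₀[θ, s, w]) α β) s := by
  have hE := hasDerivAt_symHeat θ s w α β
  have hP0 := hasDerivAt_pert0_apply h1 h4 s w α β
  have h := hE.sub hP0
  have hfun : (fun r : ℝ => (symHeat θ r w - pert0 r w) α β) =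
      fun r : ℝ => symHeat θ r w α β - pert0 r w α β := by
    funext r; simp [Matrix.sub_apply]
  rw [hfun]
  refine h.congr_deriv ?_
  have key : -(∑ v ∈ nbr2 0, Complex.exp (((θ / 2 * (wedge v w : ℤ) : ℝ) : ℂ) * Complex.I) •
        (sqKer (symLink θ) 0 v * symHeat θ s (w - v))) - -(vtx 0 (pert0 s) w) =
      -(∑ v ∈ nbr2 0, Complex.exp (((θ / 2 * (wedge v w : ℤ) : ℝ) : ℂ) * Complex.I) •
          (sqKer (symLink θ) 0 v * (symHeat θ s (w - v) - pert0 s (w - v)))) - Q₀[θ, s, w] := by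
    simp only [Matrix.mul_sub, smul_sub, Finset.sum_sub_distrib]
    abel
  have := congrFun (congrFun key α) β
  simp only [Matrix.sub_apply, Matrix.neg_apply] at this
  simpa only [Matrix.sub_apply, Matrix.neg_apply] using this

/-- `R₀(0) = 0`: at time zero both the heat symbol and `E₀` are `δ`. -/
theorem remainder₀_zero (h3 : ∀ w : Site 4, freeKer 0 w = if w = 0 then 1 else 0) (θ : ℝ) (w : Site 4) :
    symHeat θ 0 w - pert0 0 w = 0 := by
  rw [symHeat, heatKer_zero (norm_symLink_le θ), pert0, h3]
  by_cases hw : (0 : Site 4) = w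
  · subst hw; simp
  · have hw' : ¬(w = 0) := fun e => hw e.symm
    simp [hw, hw']

/-- Continuity of the entries of `R₀`. -/
theorem continuous_remainder₀_apply
    (h4 : ∀ (t : ℝ) (w : Site 4),
      HasDerivAt (fun s => freeKer s w) (-(∑ z ∈ nbr2 0, hhat z * freeKer t (w - z))) t)
    (θ : ℝ) (w : Site 4) (α β : Fin 4) :
    Continuous fun s : ℝ => (symHeat θ s w - pert0 s w) α β := by
  have hfun : (fun s : ℝ => (symHeat θ s w - pert0 s w) α β) =
      fun s : ℝ => symHeat θ s w α β - pert0 s w α β := by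
    funext s; simp [Matrix.sub_apply]
  rw [hfun]
  exact (continuous_symHeat_apply θ w α β).sub (continuous_pert0_apply h4 w α β)

/-- Continuity of the entries of the forcing `q₀` (on any set of times). -/
theorem continuousOn_forcing₀_apply
    (h4 : ∀ (t : ℝ) (w : Site 4),
      HasDerivAt (fun s => freeKer s w) (-(∑ z ∈ nbr2 0, hhat z * freeKer t (w - z))) t)
    (θ : ℝ) (w : Site 4) (α β : Fin 4) (S : Set ℝ) :
    ContinuousOn (fun s : ℝ => (Q₀[θ, s, w]) α β) S := by
  have hP0 : ∀ (y : Site 4) (γ δ : Fin 4), ContinuousOn (fun s : ℝ => pert0 s y γ δ) S :=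
    fun y γ δ => (continuous_pert0_apply h4 y γ δ).continuousOn
  have a := continuousOn_twistedGen_apply θ hP0 w α β
  have c := continuousOn_vtx_apply 0 hP0 w α β
  have hfun : (fun s : ℝ => (Q₀[θ, s, w]) α β) = fun s : ℝ =>
      (V[θ] (pert0 s) w) α β - (vtx 0 (pert0 s) w) α β := by
    funext s
    simp only [Matrix.sub_apply]
  rw [hfun]
  exact a.sub c

/-- A uniform bound of the entries of `R₀` on `[0, T]`. -/
theorem norm_remainder₀_apply_le {Ck ck : ℝ} (hck : 0 < ck)
    (hk : ∀ t : ℝ, 0 ≤ t → ∀ w : Site 4, |freeKer t w| ≤ Ck * gaussProfile ck t w)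
    (h3 : ∀ w : Site 4, freeKer 0 w = if w = 0 then 1 else 0)
    (θ T : ℝ) : ∀ s ∈ Set.Icc 0 T, ∀ (w : Site 4) (α β : Fin 4),
      ‖(symHeat θ s w - pert0 s w) α β‖ ≤ Real.exp (1679616 * T) + Ck := by
  intro s hs w α β
  have hCk : 0 ≤ Ck := zero_le_one.trans (one_le_Ck hk h3)
  rw [Matrix.sub_apply]
  refine (norm_sub_le _ _).trans (add_le_add ?_ ?_)
  · refine (norm_heatKer_apply_le (norm_symLink_le θ) s 0 w α β).trans ?_
    rw [Real.exp_le_exp, abs_of_nonneg hs.1]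
    nlinarith [hs.2]
  · exact (norm_pert0_apply_le hk hs.1 w α β).trans
      (mul_le_of_le_one_right hCk (gaussProfile_le_one hck.le hs.1 w))

/-! ## §3 The twisted Duhamel representation of `R₀` -/

/-- **Duhamel representation of `R₀`** (registered aux stub `stub_twistedDuhamel`): for `t > 0`,
`(E_θ − E₀)(t)(w)_{αβ} = −∫₀ᵗ (Σ_y Ω_θ(y,w) • (E_θ(t−s)(y) q₀(θ,s,w−y)))_{αβ} ds`. -/
theorem remainder₀_eq_integral {Ck ck : ℝ} (hck : 0 < ck)
    (hk : ∀ t : ℝ, 0 ≤ t → ∀ w : Site 4, |freeKer t w| ≤ Ck * gaussProfile ck t w)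
    (hT3 : ∀ c ε : ℝ, 0 < c → 0 < ε → ε < 1 → ∀ j : ℕ, ∃ A : ℝ, ∀ t : ℝ, 0 ≤ t → ∀ w : Site 4,
      elen w ^ j * gaussProfile c t w ≤ A * Real.sqrt (1 + t) ^ j * gaussProfile ((1 - ε) * c) t w)
    (hT4 : ∀ c ε : ℝ, 0 < c → 0 < ε → ε < 1 → ∃ A : ℝ, ∀ t : ℝ, 0 ≤ t → ∀ w z : Site 4, elen z ≤ 2 →
      gaussProfile c t (w + z) ≤ A * gaussProfile ((1 - ε) * c) t w)
    (h1 : ∀ x y : Site 4, sqKer (fun _ => (1 : ℂ)) x y = ((hhat (y - x) : ℝ) : ℂ) • (1 : Spin))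
    (h3 : ∀ w : Site 4, freeKer 0 w = if w = 0 then 1 else 0)
    (h4 : ∀ (t : ℝ) (w : Site 4),
      HasDerivAt (fun s => freeKer s w) (-(∑ z ∈ nbr2 0, hhat z * freeKer t (w - z))) t)
    (h6 : ∀ t : ℝ, 0 ≤ t → ∀ (w : Site 4) (ν : Fin 4),
      t * (∑ z ∈ nbr2 0, ((z ν : ℤ) : ℝ) * hhat z * freeKer t (w - z)) + ((w ν : ℤ) : ℝ) * freeKer t w = 0)
    (θ : ℝ) {t : ℝ} (ht : 0 < t) (w : Site 4) (α β : Fin 4) :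
    (symHeat θ t w - pert0 t w) α β =
      -∫ s in (0 : ℝ)..t, (∑' y : Site 4,
          Complex.exp (((θ / 2 * (wedge y w : ℤ) : ℝ) : ℂ) * Complex.I) •
            (symHeat θ (t - s) y * Q₀[θ, s, w - y])) α β := by
  obtain ⟨K, hK0, hq⟩ := exists_forcing₀_bound hck hk hT3 hT4 h1 h3 h6
  have hCk : 0 ≤ Ck := zero_le_one.trans (one_le_Ck hk h3)
  set BR : ℝ := Real.exp (1679616 * t) + Ck with hBR
  set Bq : ℝ := K * (θ ^ 2 * (1 + t) + |θ|) with hBq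
  have hBq0 : 0 ≤ Bq := by rw [hBq]; positivity
  have key := stub_twistedDuhamel θ t (ck / 4) (BR + Bq) ht (by positivity)
    (fun s w => symHeat θ s w - pert0 s w) (fun s w => Q₀[θ, s, w])
    (fun w => remainder₀_zero h3 θ w)
    (fun w α β => (continuous_remainder₀_apply h4 θ w α β).continuousOn)
    (fun w α β => continuousOn_forcing₀_apply h4 θ w α β _)
    (fun s _ w α β => hasDerivAt_remainder₀_apply h1 h4 θ s w α β)
    (fun s hs w α β => (norm_remainder₀_apply_le hck hk h3 θ t s hs w α β).trans (le_add_of_nonneg_right hBq0))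
    (fun s hs w α β => ?_) t ⟨ht.le, le_rfl⟩ w α β
  · exact key
  · have h := hq θ s hs.1 w α β
    refine h.trans ?_
    have hΓ := gaussProfile_nonneg (ck / 4) s w
    have hmono : K * (θ ^ 2 * (1 + s) + |θ|) ≤ Bq := by
      rw [hBq]
      have hs1 : 1 + s ≤ 1 + t := by linarith [hs.2]
      have hs0 : 0 ≤ 1 + s := by linarith [hs.1]
      gcongr
    have hBR0 : 0 ≤ BR := by rw [hBR]; positivity
    calc K * (θ ^ 2 * (1 + s) + |θ|) * gaussProfile (ck / 4) s w
        ≤ Bq * gaussProfile (ck / 4) s w := mul_le_mul_of_nonneg_right hmono hΓ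
      _ ≤ (BR + Bq) * gaussProfile (ck / 4) s w := by gcongr; linarith

/-! ## Registered headline -/

/-- Registered headline of this helper file (aux stub `stub_gaussianMajorantAux` of crux stmt-QuantumFields-16786,
line `Sketch`): the zeroth-order remainder vanishes at time zero. -/
theorem stub_gaussianMajorantAux : (∀ w : Site 4, freeKer 0 w = if w = 0 then 1 else 0) → ∀ (θ : ℝ) (w : Site 4), symHeat θ 0 w - pert0 0 w = 0 :=
  fun h3 θ w => remainder₀_zero h3 θ w

end GaussianMajorant

end Summit.QuantumFields.QCD.Cruxes.QuarkLoopCoefficient.Sketch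

end
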